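import Literature.NumberTheory.EllipticCurves.ModularSymbolsPeriodHomology
import Literature.NumberTheory.EllipticCurves.ModularSymbolsProofs
import HarnessLib

/-!
# Route `EisensteinDepletionAtTwo`, crux E1M_NSF (stmt-BirchSwinnertonDyer-27021) / GO₂-child `StarGO2Sigma` (stmt-BirchSwinnertonDyer-27046):
# the SYMBOL-side transfer identity (U1) — `∑_j {∞, γ_j∞}_f = a_ℓ(f)·{∞, γ∞}_f` for the `U_ℓ` transfer matrices `γ_j`, `ℓ ∣ N`

Cell `bsd-rank2` (HOME run/shared/lean/pub/bsd-rank2/), seat `bsd-rank2-eng-2` GEN 16. THEOREMS ONLY — no definition, no named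
fact, no `sorry`. HONEST FRAMING: bookkeeping on the symbol side of lines `star` / `kummer` (planner memo SIGMA-NSF-UNTWIST §1 (U1),
§4(c)); companion of the Eisenstein-side (U2) `stabEisensteinPeriod_heckeU_sum_eq_zero` (`…StarPeriodHecke`); nothing here reads an
analytic rank; StarGO2Sigma / E1M_NSF / BSD are NOT proved by this file (PARTITION D-0054: none — r_an ≥ 2 axis S0, door T-r3₂).

For a prime `ℓ ∣ N` the Hecke operator `T_ℓ = U_ℓ` acts on modular symbols by `{∞, r}_{U_ℓ h} = ∑_{j mod ℓ} {∞, (r + j)/ℓ}_h`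
(TREE `modularSymbol_heckeT_eq_sum`, Cremona (2.4.1)–(2.4.2)); for a newform `T_ℓ f = a_ℓ(f) f` (TREE
`IsNewform0.heckeT_eq_coeff_smul`).  For `γ = (a b; c d) ∈ Γ₀(N)`, `c ≠ 0`, the transfer matrices
`γ_j = α_j γ α_{σ_j}^{-1}` (`α_j = (1 j; 0 ℓ)`) have first column `(a + jc, ℓc)`, so `γ_j ∞ = (a + jc)/(ℓc) = (γ∞ + j)/ℓ` and

* `sum_modularSymbol_add_div_eq` — `∑_{j<ℓ} {∞, (r + j)/ℓ}_f = a_ℓ(f)·{∞, r}_f`;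
* `sum_modularSymbol_transfer_eq` — `∑_{j<ℓ} {∞, (a + jc)/(ℓc)}_f = a_ℓ(f)·{∞, a/c}_f`;
* **`sum_cuspSymbol_eq_cuspCoeff_mul_of_firstCol`** — for any `γ_j ∈ Γ₀(N)` with first columns `(a + jc, ℓc)` (`j < ℓ`):
  `∑_{j<ℓ} cuspSymbol f γ_j = a_ℓ(f) · cuspSymbol f γ` (at a traceless prime, `a_ℓ(f) = 0`, the symbol side is `U_ℓ`-null too).

References: J. E. Cremona, *Algorithms for Modular Elliptic Curves* (1997), §2.4 (2.4.1)–(2.4.2) [CremonaAlgorithms1997];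
Ju. I. Manin, Izv. 36 (1972), §1.6–1.7 [Manin1972]; A. O. L. Atkin, J. Lehner, Math. Ann. 185 (1970), Thm. 3 [AtkinLehner1970].
-/

set_option linter.dupNamespace false
set_option autoImplicit false

noncomputable section

open scoped MatrixGroups
open CongruenceSubgroup Finset
open Literature.NumberTheory.EllipticCurves.ModularForms

namespace Summit.BirchSwinnertonDyer.BirchSwinnertonDyer.Theorems.DepletionAtTwo

variable {N : ℕ} [NeZero N] {f : CuspForm (Gamma0 N) 2}

/-- **(U1) on modular symbols.**  For a newform `f ∈ S₂(Γ₀(N))` and a prime `ℓ ∣ N`: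
`∑_{j<ℓ} {∞, (r + j)/ℓ}_f = a_ℓ(f)·{∞, r}_f`. [cite: CremonaAlgorithms1997, §2.4 (2.4.1)–(2.4.2)] [cite: AtkinLehner1970, Thm. 3] -/
theorem sum_modularSymbol_add_div_eq (hf : IsNewform0 f) {ℓ : ℕ} (hℓ : ℓ.Prime) (hℓN : ℓ ∣ N) (r : ℚ) :
    ∑ j ∈ range ℓ, modularSymbol f ((r + j) / ℓ) = cuspCoeff f ℓ * modularSymbol f r := by
  haveI : NeZero ℓ := ⟨hℓ.ne_zero⟩
  have h := modularSymbol_heckeT_eq_sum ℓ f hℓ r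
  rw [if_pos hℓN, add_zero, hf.heckeT_eq_coeff_smul hℓ, modularSymbol_const_smul] at h
  rw [Finset.sum_range (fun j => modularSymbol f ((r + j) / ℓ))]
  unfold cuspCoeff
  rw [h]
  refine Finset.sum_congr rfl fun j _ => ?_
  push_cast
  rfl

/-- **(U1) at the transfer cusps.**  For a newform `f`, a prime `ℓ ∣ N`, and integers `a`, `c ≠ 0`:
`∑_{j<ℓ} {∞, (a + jc)/(ℓc)}_f = a_ℓ(f)·{∞, a/c}_f` (`(a + jc)/(ℓc) = (a/c + j)/ℓ = γ_j∞`). [cite: CremonaAlgorithms1997, §2.4 (2.4.1)–(2.4.2)] -/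
theorem sum_modularSymbol_transfer_eq (hf : IsNewform0 f) {ℓ : ℕ} (hℓ : ℓ.Prime) (hℓN : ℓ ∣ N) {a c : ℤ} (hc : c ≠ 0) :
    ∑ j ∈ range ℓ, modularSymbol f (((a + j * c : ℤ) : ℚ) / ((ℓ * c : ℤ) : ℚ)) =
      cuspCoeff f ℓ * modularSymbol f ((a : ℚ) / c) := by
  rw [← sum_modularSymbol_add_div_eq hf hℓ hℓN]
  refine Finset.sum_congr rfl fun j _ => ?_
  congr 1
  have hcq : (c : ℚ) ≠ 0 := by exact_mod_cast hc
  have hℓq : (ℓ : ℚ) ≠ 0 := by exact_mod_cast hℓ.ne_zero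
  push_cast
  field_simp

/-- **(U1) for cusp symbols along the `U_ℓ` transfer matrices.**  Let `f ∈ S₂(Γ₀(N))` be a newform, `ℓ ∣ N` prime,
`γ ∈ Γ₀(N)` with `c(γ) ≠ 0`, and `γ_j ∈ Γ₀(N)` (`j < ℓ`) any elements with first column `(a(γ) + j·c(γ), ℓ·c(γ))` — e.g. the
transfer matrices `α_j γ α_{σ_j}^{-1}` of `U_ℓ`.  Then `∑_{j<ℓ} {∞, γ_j∞}_f = a_ℓ(f)·{∞, γ∞}_f`.
[cite: CremonaAlgorithms1997, §2.4 (2.4.1)–(2.4.2)] [cite: Manin1972, §1.6–1.7] -/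
theorem sum_cuspSymbol_eq_cuspCoeff_mul_of_firstCol (hf : IsNewform0 f) {ℓ : ℕ} (hℓ : ℓ.Prime) (hℓN : ℓ ∣ N)
    (γ : Gamma0 N) (hc : (γ : SL(2, ℤ)) 1 0 ≠ 0) (γs : ℕ → Gamma0 N)
    (h0 : ∀ j < ℓ, (γs j : SL(2, ℤ)) 0 0 = (γ : SL(2, ℤ)) 0 0 + j * (γ : SL(2, ℤ)) 1 0)
    (h1 : ∀ j < ℓ, (γs j : SL(2, ℤ)) 1 0 = ℓ * (γ : SL(2, ℤ)) 1 0) :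
    ∑ j ∈ range ℓ, cuspSymbol f (γs j) = cuspCoeff f ℓ * cuspSymbol f γ := by
  have hℓc : (ℓ : ℤ) * (γ : SL(2, ℤ)) 1 0 ≠ 0 := mul_ne_zero (by exact_mod_cast hℓ.ne_zero) hc
  have e : ∀ j ∈ range ℓ, cuspSymbol f (γs j) =
      modularSymbol f ((((γ : SL(2, ℤ)) 0 0 + j * (γ : SL(2, ℤ)) 1 0 : ℤ) : ℚ) / ((ℓ * (γ : SL(2, ℤ)) 1 0 : ℤ) : ℚ)) := by
    intro j hj
    have hj' := mem_range.mp hj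
    unfold cuspSymbol
    rw [h1 j hj', if_neg hℓc, h0 j hj']
  rw [sum_congr rfl e, sum_modularSymbol_transfer_eq hf hℓ hℓN hc]
  unfold cuspSymbol
  rw [if_neg hc]

end Summit.BirchSwinnertonDyer.BirchSwinnertonDyer.Theorems.DepletionAtTwo

end
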